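import Summits.QuantumFields.YangMills.Theorems.BalabanUVNodesN15NeumannCubeMajorant
import Summits.QuantumFields.YangMills.Theorems.BalabanUVNodesN15PartitionSupport
import Summits.QuantumFields.YangMills.Theorems.BalabanUVNodesN15TwoSpacingGluingSymbolBridge
import HarnessLib

/-!
# THE GLUING STEP AT TWO LATTICE SPACINGS, XXIV: THE CUBE COVER OF THE DOUBLED TORUS — `(2q)^{d+1}` TRANSLATED NEUMANN CUBES OF SIDE `qw` BLOCKS ON KING's TORUS `M_ν = 2qw`,
# THE SAMPLED PARTITION (2.36) AT RESOLUTION `w`, AND THE GEOMETRY THE KNIT NEEDS: shift compatibility, `supp h_k ⊂ interior bonds of □_k` (the locality hypothesis `hloc`), the cut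
# `χ_{□_k} = 1` one step around `supp h_k`, a MARGIN of `m₀` blocks, bounded overlap (dag-n15-c g12, FILE 66; N15 = NE2, s1 «background-layer OPERATOR ingredient»)

Cell `pub-ymgap`, seat `pub-ymgap-dag-n15-c` (R134 (a); HUMAN RULING D-0062), generation 12.  `bears_on: R4∕N15 · K3⁷ SpineGivenEndpointR13SepCoPH (stmt-QuantumFields-20544)`.
Filed `--supports stmt-QuantumFields-20544 --as helper` — COUNT-NEUTRAL.  Two plumbing `def`s (`coverXi`, `coverCorner`), the rest theorems; 0 `sorry`.  Imports BY NAME dag-n15-a N-IIIb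
`…N15NeumannCubeMajorant` (`cubeBlocks`, `chiCube`, `intBonds`, `up`), FILE 65 `…N15PartitionSupport` (through it 59–61: `hcube`, `cenRep`, `abs_cenRep_lt_one_of_hcube_ne_zero`) and FILE 62
`…TwoSpacingGluingSymbolBridge` (`bshiftEquiv`); nothing in the tree is modified.

WHY ((Γ14′) of the g11 HANDOFF — THE KNIT CALL).  FILE 63 ★★★ `hasMaj_glued_of_cutRows` ∕ `hasMaj_idef_glued_of_cutRows` glue cube-localized propagators with cut letters; dag-n15-a's
PROGRAMME N (17 files, g19) supplies every row for its Neumann-by-images cube `neumannCubeG M n c S a` on the DOUBLED torus `M_ν = 2S` — for EVERY cube position `c`.  One cube with `h ≡ 1` is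
the trivial instance (ref-B OBS-2); the honest instance covers the doubled torus by the `(2q)^{d+1}` TRANSLATES `□_k = c(k) + [0, qw)^{d+1}` (`S = qw`, `k ∈ (ℤ∕2q)^{d+1}`) and the
sampled partition `h_k = Π_ν Θ_{2q}(ξ_ν − k_ν)` of FILES 59–61 at resolution `w` blocks (`ξ_ν(x) = x_ν∕(nw)`): `supp h_k` has width `2w` blocks and sits inside `□_k` (side `qw ≥ 3w`) with a
margin `m₀`, `2m₀ + 2w + 1 ≤ qw`.  The partition's derivative letters are `O(w⁻¹)` (FILE 61: `c₁ = π∕w`, `c₂ = 32π²∕w²`), so `w` is [B6]'s «M sufficiently large» and the knit's smallness reads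
`w ≥ w₀` — the guard «M ≥ M₁» of [B9] Thm 3.1 LIVE on dag-n15-a's family (`q = L`, `w = L^m`, `S = L^{m+1}`).
* §1 defs `coverXi M n w ν b = val(b.1 ν)∕(nw)`, `coverCorner M w q m₀ k = (w(k_ν − 1) − m₀)_ν`; ★ `coverXi_shift` (FILE 61's `hξ` for `e = bshiftEquiv`, `s = (nw)⁻¹`, `K = 2q`).
* §2 `sub_up_coverCorner_eq`, ★★ `val_sub_up_of_abs_cenRep_lt_one` ∕ `val_sub_up_of_hcube_ne_zero` (the RELATIVE fine coordinates of a point of `supp h_k` lie in `[nm₀ + 1, n(m₀ + 2w) − 1]`), ★★ `mem_intBonds_of_hcube_ne_zero` (`supp h_k ⊂` interior bonds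
  of `□_k`: dag-n15-a N-IIIa's `hloc` hypothesis `hh`), `blockOf_mem_cubeBlocks_iff`, ★★ `chiCube_coverCorner_eq_one` (FILE 65's cut hypothesis `hχ` for `χ = χ_{□_k}`: the cut is `1` one
  step around the open support cube), `blockOf_mem_cubeBlocks_of_hcube_ne_zero`.
* §3 ★ `sum_ind_cubeBlocks_le` (overlap `N_ov ≤ (2q)^{d+1}`), ★ `margin_le_tdistT` (a block outside `□_k` and a block of the support window are `≥ m₀ + 1` apart on the torus).

HONEST FRAMING ∕ LIMITS.  Finite lattice geometry on `(ℤ∕2qwn)^{d+1}` (casts, `round`, `ZMod.val`); no estimate; [B6] (2.36)–(2.37) p.229, p.239 («ζ_□ … distance ⅓M to the boundary of □»: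
the margin) = SHAPES.  `U ≡ 1` doubled-cube torus MODEL of dag-n15-a; nothing of [B5]∕[B6]∕[B9] asserted.  NE2⁺ NOT PRINTED, NOT proved; N15 NOT discharged; counts of record UNMOVED (typed
28∕28 · discharged 5∕27); one finite 𝕋⁴ at fixed ε — NOT infinite volume, NOT OS on ℝ⁴, NOT a mass gap, NOT Clay; R4 closes the conditional finite-𝕋⁴ rung `BalabanLadder.UV` only.
Restate-immune (no Theses import).
-/

noncomputable section

namespace Summit.QuantumFields.YangMills.BalabanUVNodes.N15.Gluing

open Literature.MathematicalPhysics.QuantumFieldTheory.Balaban1983to89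
open Literature.MathematicalPhysics.QuantumFieldTheory.Balaban1983to89.B5Prop11Plancherel (Tor fine unitVec)
open Literature.MathematicalPhysics.QuantumFieldTheory.Balaban1983to89.B5Block118 (up upHom_intCast)
open Literature.MathematicalPhysics.QuantumFieldTheory.Balaban1983to89.B6Prop26Gluing (ind ind_nonneg ind_le_one)
open Literature.MathematicalPhysics.QuantumFieldTheory.Balaban1983to89.B4TorusKernel.MultiPeriod (circAbs circAbs_add_mul)
open Literature.MathematicalPhysics.QuantumFieldTheory.Balaban1983to89.B4Sect5Torus (tdist circAbs_le_tdist)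
open Literature.MathematicalPhysics.QuantumFieldTheory.King1986.Torus (blockOf val_blockOf tdistT toSite)
open Literature.MathematicalPhysics.QuantumFieldTheory.Balaban1983to89.B6UnitTorusCarrier (unitTorusGeo)
open Summit.QuantumFields.YangMills.BalabanUVNodes.N15.TwoGrid (cubeBlocks mem_cubeBlocks chiCube intBonds mem_intBonds blockOf_sub_up exists_val_sub_eq)
open Summit.QuantumFields.YangMills.BalabanUVNodes.N15.VectorPiece (bshiftEquiv bshiftEquiv_apply bshiftEquiv_symm_apply)

variable {d : ℕ}

/-! ## §1 The cover data: coordinates `ξ_ν`, cube corners `c(k)`, shift compatibility -/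

section Defs

variable (M : Fin (d + 1) → ℕ) (n w : ℕ)

/-- THE PARTITION COORDINATES at spacing `n` fine points per block and resolution `w` blocks: `ξ_ν(b) = val(b_ν)∕(nw)` (one unit of `ξ` = `w` blocks; the sampled partition of FILE 61
is `h_k = Π_ν Θ_{2q}(ξ_ν − k_ν)`). [cite: Balaban1984PropagatorsII, (2.36) p.229 («rescale them to proper scales»: shape)] -/
def coverXi (ν : Fin (d + 1)) (b : Tor (fine n M) × Fin (d + 1)) : ℝ := ((b.1 ν).val : ℝ) / ((n : ℝ) * w)

/-- THE CORNER OF THE CUBE `□_k` carrying `h_k`: `c(k)_ν = w(k_ν − 1) − m₀` blocks, so that the support window `[w(k_ν − 1), w(k_ν + 1)]` of `h_k` sits inside `[c_ν, c_ν + qw)` with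
margin `m₀` below (and `qw − 2w − m₀ ≥ m₀ + 1` above). [cite: Balaban1984PropagatorsII, (2.37) p.229 (the cubes of the cover), p.239 (the margin of `ζ_□`)] -/
def coverCorner (q m₀ : ℕ) (k : Fin (d + 1) → ZMod (2 * q)) : Tor M := fun ν => ((((w : ℤ) * ((k ν).val : ℤ) - w - m₀ : ℤ)) : ZMod (M ν))

end Defs

section Shift

variable {M : Fin (d + 1) → ℕ} [∀ μ, NeZero (M μ)] {n w q : ℕ} [NeZero n]

/-- ★ **SHIFT COMPATIBILITY** (FILE 61's `hξ` for the bond shifts `e_μ = bshiftEquiv`, step `s = (nw)⁻¹`, period `K = 2q`): `ξ_ν(x + e_μ) = ξ_ν(x) + δ_{νμ}(nw)⁻¹ + z·2q`, `z ∈ {0, −1}`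
(the wrap of `ℤ∕2qwn`). [folklore] -/
theorem coverXi_shift (hM : ∀ ν, M ν = 2 * q * w) (hw : 0 < w) (μ ν : Fin (d + 1)) (b : Tor (fine n M) × Fin (d + 1)) :
    ∃ z : ℤ, coverXi M n w ν (bshiftEquiv M n μ b) = coverXi M n w ν b + (if ν = μ then ((n : ℝ) * w)⁻¹ else 0) + (z : ℝ) * ((2 * q : ℕ) : ℝ) := by
  have hn : 0 < n := Nat.pos_of_ne_zero (NeZero.ne n)
  have hnw : (0 : ℝ) < (n : ℝ) * w := by positivity
  unfold coverXi
  rw [bshiftEquiv_apply]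
  by_cases hνμ : ν = μ
  · subst hνμ
    simp only [Pi.add_apply, unitVec, Pi.single_eq_same, if_true]
    have hN : fine n M ν = n * (2 * q * w) := by show n * M ν = _; rw [hM ν]
    have hval : (b.1 ν + 1).val = (((b.1 ν).val + 1) % fine n M ν) := by
      rw [ZMod.val_add, ZMod.val_one_eq_one_mod, Nat.add_mod_mod]
    by_cases hlt : (b.1 ν).val + 1 < fine n M ν
    · refine ⟨0, ?_⟩
      rw [hval, Nat.mod_eq_of_lt hlt]
      push_cast
      field_simp
      ring
    · have hle : fine n M ν ≤ (b.1 ν).val + 1 := not_lt.mp hlt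
      have hlt' : (b.1 ν).val < fine n M ν := ZMod.val_lt _
      have heq : (b.1 ν).val + 1 = fine n M ν := by omega
      refine ⟨-1, ?_⟩
      rw [hval, heq, Nat.mod_self]
      have hcast : (((b.1 ν).val : ℝ)) = (n : ℝ) * (2 * q * w) - 1 := by
        have h1 : (((b.1 ν).val + 1 : ℕ) : ℝ) = ((fine n M ν : ℕ) : ℝ) := by rw [heq]
        have h3 : ((M ν : ℕ) : ℝ) = 2 * q * w := by rw [hM ν]; push_cast; ring
        push_cast at h1; rw [h3] at h1; linarith
      rw [hcast]
      push_cast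
      field_simp
      ring
  · refine ⟨0, ?_⟩
    have hne : (unitVec (fine n M) μ) ν = 0 := by simp [unitVec, Pi.single_eq_of_ne hνμ]
    simp only [Pi.add_apply, hne, add_zero, if_neg hνμ]
    push_cast
    ring

end Shift

/-! ## §2 Support window, interior bonds, the cut -/

section Support

variable {M : Fin (d + 1) → ℕ} [∀ μ, NeZero (M μ)] {n w q m₀ : ℕ} [NeZero n]

/-- `x_ν − (n·c(k))_ν` as the cast of ONE integer: `val(x_ν) − n(w(k_ν − 1) − m₀)`. [folklore] -/
theorem sub_up_coverCorner_eq (k : Fin (d + 1) → ZMod (2 * q)) (x : Tor (fine n M)) (ν : Fin (d + 1)) :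
    x ν - up n M (coverCorner M w q m₀ k) ν = ((((x ν).val : ℤ) - (n : ℤ) * ((w : ℤ) * ((k ν).val : ℤ) - w - m₀) : ℤ) : ZMod (fine n M ν)) := by
  have hx : x ν = ((((x ν).val : ℤ)) : ZMod (fine n M ν)) := by rw [Int.cast_natCast, ZMod.natCast_zmod_val]
  rw [up, coverCorner, upHom_intCast]
  conv_lhs => rw [hx]
  push_cast
  ring

/-- ★★ **THE SUPPORT WINDOW IN RELATIVE FINE COORDINATES**: if `h_k(b) ≠ 0` then, in every direction, `nm₀ + 1 ≤ val(b_ν − (n·c(k))_ν) ≤ n(m₀ + 2w) − 1` (torus `M_ν = 2qw`, window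
`2m₀ + 2w + 1 ≤ qw` not even needed here beyond `m₀ + 2w ≤ 2qw`). [cite: Balaban1984PropagatorsII, (2.36) p.229 (supp h_□ ⊂ □: shape)] -/
theorem val_sub_up_of_abs_cenRep_lt_one (hM : ∀ ν, M ν = 2 * q * w) (hw : 0 < w) (hfit : m₀ + 2 * w ≤ 2 * q * w) {k : Fin (d + 1) → ZMod (2 * q)}
    {b : Tor (fine n M) × Fin (d + 1)} {ν : Fin (d + 1)} (hc : |cenRep (2 * q) (coverXi M n w ν b - ((k ν).val : ℝ))| < 1) :
    n * m₀ + 1 ≤ ((b.1 - up n M (coverCorner M w q m₀ k)) ν).val ∧ ((b.1 - up n M (coverCorner M w q m₀ k)) ν).val + 1 ≤ n * (m₀ + 2 * w) := by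
  have hn : 0 < n := Nat.pos_of_ne_zero (NeZero.ne n)
  have hnw : (0 : ℝ) < (n : ℝ) * w := by positivity
  have hq : 0 < q := Nat.pos_of_ne_zero (by rintro rfl; omega)
  have hN : fine n M ν = n * (2 * q * w) := by show n * M ν = _; rw [hM ν]
  haveI : NeZero (fine n M ν) := ⟨by rw [hN]; positivity⟩
  rw [Pi.sub_apply]
  -- the open-cube condition in the `ξ`-coordinates
  unfold cenRep coverXi at hc
  set t : ℕ := (b.1 ν).val with ht
  set kv : ℕ := (k ν).val with hkv
  set R : ℤ := round (((t : ℝ) / ((n : ℝ) * w) - (kv : ℝ)) / ((2 * q : ℕ) : ℝ)) with hR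
  -- integer form: |t − nw·kv − N·R| < nw
  have hreal : |(t : ℝ) - (n : ℝ) * w * kv - (n : ℝ) * (2 * q * w) * R| < (n : ℝ) * w := by
    have hne : (n : ℝ) * w ≠ 0 := hnw.ne'
    calc |(t : ℝ) - (n : ℝ) * w * kv - (n : ℝ) * (2 * q * w) * R|
        = |((t : ℝ) / ((n : ℝ) * w) - (kv : ℝ) - ((2 * q : ℕ) : ℝ) * (R : ℝ)) * ((n : ℝ) * w)| := by
          congr 1; push_cast; field_simp
      _ = |(t : ℝ) / ((n : ℝ) * w) - (kv : ℝ) - ((2 * q : ℕ) : ℝ) * (R : ℝ)| * ((n : ℝ) * w) := by rw [abs_mul, abs_of_pos hnw]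
      _ < 1 * ((n : ℝ) * w) := mul_lt_mul_of_pos_right hc hnw
      _ = (n : ℝ) * w := one_mul _
  have hint : |(t : ℤ) - (n : ℤ) * w * kv - (n : ℤ) * (2 * q * w) * R| < (n : ℤ) * w := by
    have h1 : (((t : ℤ) - (n : ℤ) * w * kv - (n : ℤ) * (2 * q * w) * R : ℤ) : ℝ) = (t : ℝ) - (n : ℝ) * w * kv - (n : ℝ) * (2 * q * w) * R := by push_cast; ring
    have h2 : (((n : ℤ) * w : ℤ) : ℝ) = (n : ℝ) * w := by push_cast; ring
    have h3 : ((|(t : ℤ) - (n : ℤ) * w * kv - (n : ℤ) * (2 * q * w) * R| : ℤ) : ℝ) < (((n : ℤ) * w : ℤ) : ℝ) := by rw [Int.cast_abs, h1, h2]; exact hreal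
    exact_mod_cast h3
  -- the relative coordinate is the cast of `v := t − n·c₀ − N·R`, which lies in the window
  set v : ℤ := (t : ℤ) - (n : ℤ) * ((w : ℤ) * kv - w - m₀) - (n : ℤ) * (2 * q * w) * R with hv
  have hvlo : (n : ℤ) * m₀ < v := by
    have := (abs_lt.mp hint).1
    simp only [hv]; nlinarith
  have hvhi : v < (n : ℤ) * (m₀ + 2 * w) := by
    have := (abs_lt.mp hint).2
    simp only [hv]; nlinarith
  have hv0 : 0 ≤ v := by nlinarith
  have hvN : v < (fine n M ν : ℕ) := by
    rw [hN]; push_cast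
    have : (n : ℤ) * (m₀ + 2 * w) ≤ (n : ℤ) * (2 * q * w) := by exact_mod_cast Nat.mul_le_mul_left n hfit
    linarith
  have hcast : b.1 ν - up n M (coverCorner M w q m₀ k) ν = ((v : ℤ) : ZMod (fine n M ν)) := by
    rw [sub_up_coverCorner_eq, hv, ← ht, ← hkv]
    have hNz : (n : ZMod (fine n M ν)) * (2 * (q : ZMod (fine n M ν)) * (w : ZMod (fine n M ν))) = 0 := by
      have h1 : (((fine n M ν : ℕ)) : ZMod (fine n M ν)) = 0 := ZMod.natCast_self _
      have h2 : (((fine n M ν : ℕ)) : ZMod (fine n M ν)) = (n : ZMod (fine n M ν)) * (2 * (q : ZMod (fine n M ν)) * (w : ZMod (fine n M ν))) := by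
        rw [hN]; push_cast; ring
      rw [← h2, h1]
    push_cast
    linear_combination (R : ZMod (fine n M ν)) * hNz
  have hval : (((b.1 ν - up n M (coverCorner M w q m₀ k) ν).val : ℤ)) = v := by rw [hcast, ZMod.val_intCast, Int.emod_eq_of_lt hv0 hvN]
  constructor
  · have : ((n * m₀ + 1 : ℕ) : ℤ) ≤ (((b.1 ν - up n M (coverCorner M w q m₀ k) ν).val : ℕ) : ℤ) := by rw [hval]; push_cast; linarith
    exact_mod_cast this
  · have : ((((b.1 ν - up n M (coverCorner M w q m₀ k) ν).val + 1 : ℕ) : ℤ)) ≤ ((n * (m₀ + 2 * w) : ℕ) : ℤ) := by push_cast; rw [hval]; linarith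
    exact_mod_cast this

/-- ★★ **THE SUPPORT WINDOW**: if `h_k(b) ≠ 0` then in every direction `nm₀ + 1 ≤ val((b − n·c(k))_ν) ≤ n(m₀ + 2w) − 1`. [cite: Balaban1984PropagatorsII, (2.36) p.229 (supp h_□ ⊂ □: shape)] -/
theorem val_sub_up_of_hcube_ne_zero (hM : ∀ ν, M ν = 2 * q * w) (hw : 0 < w) (hfit : m₀ + 2 * w ≤ 2 * q * w) {k : Fin (d + 1) → ZMod (2 * q)}
    {b : Tor (fine n M) × Fin (d + 1)} (hb : hcube (2 * q) (coverXi M n w) k b ≠ 0) (ν : Fin (d + 1)) :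
    n * m₀ + 1 ≤ ((b.1 - up n M (coverCorner M w q m₀ k)) ν).val ∧ ((b.1 - up n M (coverCorner M w q m₀ k)) ν).val + 1 ≤ n * (m₀ + 2 * w) :=
  val_sub_up_of_abs_cenRep_lt_one hM hw hfit (abs_cenRep_lt_one_of_hcube_ne_zero (2 * q) (coverXi M n w) hb ν)

/-- ★★ **`supp h_k ⊂` THE INTERIOR BONDS OF `□_k`** — dag-n15-a N-IIIa `mulOp_comp_deltaOp_comp_neumannCubeG`'s hypothesis `hh`, hence FILE 45's per-cube locality `hloc` for the UNCUT
images propagator `G(□_k)`: needs only `m₀ + 2w + 1 ≤ qw` (the seam layer `val = qwn − 1` is never reached since `n ≥ 1`). [cite: Balaban1984PropagatorsII, (2.37)–(2.38) p.229] -/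
theorem mem_intBonds_of_hcube_ne_zero (hM : ∀ ν, M ν = 2 * q * w) (hw : 0 < w) (hfit : m₀ + 2 * w + 1 ≤ q * w) {k : Fin (d + 1) → ZMod (2 * q)}
    {b : Tor (fine n M) × Fin (d + 1)} (hb : hcube (2 * q) (coverXi M n w) k b ≠ 0) : b ∈ intBonds M n (coverCorner M w q m₀ k) (q * w) := by
  have hn : 1 ≤ n := Nat.one_le_iff_ne_zero.mpr (NeZero.ne n)
  have hwin := fun ν => val_sub_up_of_hcube_ne_zero (m₀ := m₀) hM hw (by nlinarith) hb ν
  have hup : n * (m₀ + 2 * w) + n ≤ q * w * n := by nlinarith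
  rw [mem_intBonds]
  refine ⟨fun ν => ?_, ?_⟩
  · have := (hwin ν).2
    show ((b.1 - up n M (coverCorner M w q m₀ k)) ν).val < q * w * n
    omega
  · have := (hwin b.2).2
    show ((b.1 - up n M (coverCorner M w q m₀ k)) b.2).val ≠ q * w * n - 1
    omega

/-- **BLOCKS OF THE CUBE, READ ON FINE RELATIVE COORDINATES**: `B(x) ∈ cubeBlocks c S ⟺ ∀ ν, val((x − n·c)_ν) < Sn`. [folklore] -/
theorem blockOf_mem_cubeBlocks_iff {c : Tor M} {S : ℕ} (x : Tor (fine n M)) : blockOf n M x ∈ cubeBlocks M c S ↔ ∀ ν, ((x - up n M c) ν).val < S * n := by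
  have hn : 0 < n := Nat.pos_of_ne_zero (NeZero.ne n)
  rw [mem_cubeBlocks]
  refine forall_congr' fun ν => ?_
  rw [show blockOf n M x ν - c ν = (blockOf n M x - c) ν from rfl, ← blockOf_sub_up, val_blockOf, Nat.div_lt_iff_lt_mul hn]

omit [∀ μ, NeZero (M μ)] [NeZero n] in
/-- one fine step inside the window does not wrap: `val((a + ε)) = val a + ε` for `ε ∈ {0, 1, −1}`-moves of a coordinate with `1 ≤ val a ≤ N − 2`; here the three cases FILE 65 quantifies
over (`x₀ = x`, `x₀ = x + e_μ`, `x₀ = x − e_μ`) bounded at once: `val((x − n·c)_ν) ≤ val((x₀ − n·c)_ν) + 1`. [folklore] -/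
theorem val_sub_up_le_of_step {c : Tor M} (μ : Fin (d + 1)) {x x₀ : Tor (fine n M) × Fin (d + 1)}
    (hx₀ : x₀ = x ∨ x₀ = bshiftEquiv M n μ x ∨ x₀ = (bshiftEquiv M n μ).symm x) (ν : Fin (d + 1)) (h1 : 1 ≤ ((x₀.1 - up n M c) ν).val)
    (h2 : ((x₀.1 - up n M c) ν).val + 2 ≤ fine n M ν) : ((x.1 - up n M c) ν).val ≤ ((x₀.1 - up n M c) ν).val + 1 := by
  haveI : NeZero (fine n M ν) := ⟨by omega⟩
  rcases hx₀ with h | h | h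
  · rw [h]; omega
  · -- `x = x₀ − e_μ`
    have hx : x = (bshiftEquiv M n μ).symm x₀ := by rw [h, Equiv.symm_apply_apply]
    rw [hx, bshiftEquiv_symm_apply]
    have e1 : (x₀.1 - unitVec (fine n M) μ - up n M c) ν = (x₀.1 - up n M c) ν - (unitVec (fine n M) μ) ν := by
      simp only [Pi.sub_apply]; ring
    rw [e1]
    have hv1 : (1 : ZMod (fine n M ν)).val = 1 := by rw [ZMod.val_one_eq_one_mod, Nat.mod_eq_of_lt (by omega)]
    by_cases hνμ : ν = μ
    · subst hνμ
      rw [show (unitVec (fine n M) ν) ν = 1 by simp [unitVec], ZMod.val_sub (by rw [hv1]; exact h1), hv1]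
      omega
    · rw [show (unitVec (fine n M) μ) ν = 0 by simp [unitVec, Pi.single_eq_of_ne hνμ], sub_zero]
      omega
  · -- `x = x₀ + e_μ`
    have hx : x = bshiftEquiv M n μ x₀ := by rw [h, Equiv.apply_symm_apply]
    rw [hx, bshiftEquiv_apply]
    have e1 : (x₀.1 + unitVec (fine n M) μ - up n M c) ν = (x₀.1 - up n M c) ν + (unitVec (fine n M) μ) ν := by
      simp only [Pi.sub_apply, Pi.add_apply]; ring
    rw [e1]
    have hv1 : (1 : ZMod (fine n M ν)).val = 1 := by rw [ZMod.val_one_eq_one_mod, Nat.mod_eq_of_lt (by omega)]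
    by_cases hνμ : ν = μ
    · subst hνμ
      rw [show (unitVec (fine n M) ν) ν = 1 by simp [unitVec], ZMod.val_add, hv1, Nat.mod_eq_of_lt (by omega)]
    · rw [show (unitVec (fine n M) μ) ν = 0 by simp [unitVec, Pi.single_eq_of_ne hνμ], add_zero]
      omega

/-- ★★ **THE CUT IS `1` ONE STEP AROUND THE SUPPORT** — FILE 65's hypothesis `hχ` for `χ = χ_{□_k}` (dag-n15-a `chiCube`, the indicator of the cube's BLOCKS read on bonds): whenever `x`,
`x + e_μ` or `x − e_μ` lies in the open support cube of `h_k`, the block of `x` is a block of `□_k`.  Window `m₀ + 2w + 1 ≤ qw`. [cite: Balaban1984PropagatorsII, (2.37) p.229 (shape)] -/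
theorem chiCube_coverCorner_eq_one (hM : ∀ ν, M ν = 2 * q * w) (hw : 0 < w) (hfit : m₀ + 2 * w + 1 ≤ q * w) (μ : Fin (d + 1)) (k : Fin (d + 1) → ZMod (2 * q))
    (x : Tor (fine n M) × Fin (d + 1))
    (hx : ∃ x₀ : Tor (fine n M) × Fin (d + 1), (x₀ = x ∨ x₀ = bshiftEquiv M n μ x ∨ x₀ = (bshiftEquiv M n μ).symm x) ∧
      ∀ ν, |cenRep (2 * q) (coverXi M n w ν x₀ - ((k ν).val : ℝ))| < 1) :
    chiCube M n (coverCorner M w q m₀ k) (q * w) x = 1 := by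
  have hn : 1 ≤ n := Nat.one_le_iff_ne_zero.mpr (NeZero.ne n)
  obtain ⟨x₀, hx₀, hc⟩ := hx
  have hwin := fun ν => val_sub_up_of_abs_cenRep_lt_one (m₀ := m₀) hM hw (by nlinarith) (hc ν)
  have hmem : blockOf n M x.1 ∈ cubeBlocks M (coverCorner M w q m₀ k) (q * w) := by
    rw [blockOf_mem_cubeBlocks_iff]
    intro ν
    have hN : fine n M ν = n * (2 * q * w) := by show n * M ν = _; rw [hM ν]
    have h2 : ((x₀.1 - up n M (coverCorner M w q m₀ k)) ν).val + 2 ≤ fine n M ν := by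
      have := (hwin ν).2
      calc ((x₀.1 - up n M (coverCorner M w q m₀ k)) ν).val + 2 ≤ n * (2 * q * w) := by nlinarith
        _ = fine n M ν := hN.symm
    have hstep := val_sub_up_le_of_step μ hx₀ ν (by have := (hwin ν).1; omega) h2
    have := (hwin ν).2
    have hup : n * (m₀ + 2 * w) + n ≤ q * w * n := by nlinarith
    omega
  unfold chiCube
  rw [if_pos hmem]

/-- the block of a point of `supp h_k` is a block of `□_k` (case `x₀ = x` of the above). [folklore] -/
theorem blockOf_mem_cubeBlocks_of_hcube_ne_zero (hM : ∀ ν, M ν = 2 * q * w) (hw : 0 < w) (hfit : m₀ + 2 * w + 1 ≤ q * w) {k : Fin (d + 1) → ZMod (2 * q)}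
    {b : Tor (fine n M) × Fin (d + 1)} (hb : hcube (2 * q) (coverXi M n w) k b ≠ 0) : blockOf n M b.1 ∈ cubeBlocks M (coverCorner M w q m₀ k) (q * w) := by
  have h := chiCube_coverCorner_eq_one (m₀ := m₀) hM hw hfit 0 k b ⟨b, Or.inl rfl, abs_cenRep_lt_one_of_hcube_ne_zero (2 * q) (coverXi M n w) hb⟩
  unfold chiCube at h
  by_contra hne
  rw [if_neg hne] at h
  exact zero_ne_one h

/-- the SUPPORT WINDOW ON BLOCKS: `m₀ ≤ val((B(b) − c(k))_ν) ≤ m₀ + 2w − 1` for `b ∈ supp h_k`. [folklore] -/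
theorem val_blockOf_sub_of_hcube_ne_zero (hM : ∀ ν, M ν = 2 * q * w) (hw : 0 < w) (hfit : m₀ + 2 * w ≤ 2 * q * w) {k : Fin (d + 1) → ZMod (2 * q)}
    {b : Tor (fine n M) × Fin (d + 1)} (hb : hcube (2 * q) (coverXi M n w) k b ≠ 0) (ν : Fin (d + 1)) :
    m₀ ≤ ((blockOf n M b.1 - coverCorner M w q m₀ k) ν).val ∧ ((blockOf n M b.1 - coverCorner M w q m₀ k) ν).val + 1 ≤ m₀ + 2 * w := by
  have hn : 0 < n := Nat.pos_of_ne_zero (NeZero.ne n)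
  have hwin := val_sub_up_of_hcube_ne_zero (m₀ := m₀) hM hw hfit hb ν
  rw [← blockOf_sub_up, val_blockOf]
  constructor
  · exact (Nat.le_div_iff_mul_le hn).mpr (by linarith [hwin.1])
  · have : ((b.1 - up n M (coverCorner M w q m₀ k)) ν).val / n < m₀ + 2 * w := (Nat.div_lt_iff_lt_mul hn).mpr (by linarith [hwin.2])
    omega

end Support

/-! ## §3 Overlap and margin -/

section Overlap

variable {M : Fin (d + 1) → ℕ} [∀ μ, NeZero (M μ)] {w q m₀ : ℕ}

/-- ★ **BOUNDED OVERLAP** (FILE 45's `hN`, crude): every block meets at most `(2q)^{d+1}` of the cubes `□_k` (their number). [cite: Balaban1984PropagatorsII, (2.134)–(2.135) p.247 (mechanism)] -/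
theorem sum_ind_cubeBlocks_le [NeZero q] (L kk : ℕ) (y : Tor M) :
    ∑ k : Fin (d + 1) → ZMod (2 * q), ind (g := unitTorusGeo L kk M) ((cubeBlocks M (coverCorner M w q m₀ k) (q * w) : Finset (Tor M)) : Set (Tor M)) y ≤
      (((2 * q) ^ (d + 1) : ℕ) : ℝ) := by
  calc ∑ k : Fin (d + 1) → ZMod (2 * q), ind (g := unitTorusGeo L kk M) ((cubeBlocks M (coverCorner M w q m₀ k) (q * w) : Finset (Tor M)) : Set (Tor M)) y
      ≤ ∑ _k : Fin (d + 1) → ZMod (2 * q), (1 : ℝ) := Finset.sum_le_sum fun k _ => ind_le_one _ _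
    _ = (((2 * q) ^ (d + 1) : ℕ) : ℝ) := by
        rw [Finset.sum_const, Finset.card_univ, nsmul_eq_mul, mul_one, Fintype.card_fun, ZMod.card, Fintype.card_fin]

/-- ★ **THE MARGIN**: a block OUTSIDE the cube `c + [0, qw)^{d+1}` and a block of the window `c + [m₀, m₀ + 2w]^{d+1}` are at torus distance `≥ m₀ + 1` (torus `M_ν = 2qw`,
`2m₀ + 2w + 1 ≤ qw`: the far way round is `≥ m₀ + 1` too). [cite: Balaban1984PropagatorsII, p.239 («ζ_□ … with a boundary having the distance ⅓M to the boundary of □»: shape)] -/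
theorem margin_le_tdistT (hM : ∀ ν, M ν = 2 * q * w) (hfit : 2 * m₀ + 2 * w + 1 ≤ q * w) {c y y' : Tor M} (hy : y ∉ cubeBlocks M c (q * w))
    (hy' : ∀ ν, m₀ ≤ ((y' - c) ν).val ∧ ((y' - c) ν).val + 1 ≤ m₀ + 2 * w) : (m₀ : ℝ) + 1 ≤ tdistT M y y' := by
  rw [mem_cubeBlocks] at hy
  push Not at hy
  obtain ⟨ν, hν⟩ := hy
  have hP : ∀ i, 1 ≤ M i := fun i => Nat.one_le_iff_ne_zero.mpr (NeZero.ne (M i))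
  have hA := ZMod.val_lt ((y - c) ν)
  obtain ⟨hB1, hB2⟩ := hy' ν
  obtain ⟨k₁, hk₁⟩ := exists_val_sub_eq (y ν) (c ν)
  obtain ⟨k₂, hk₂⟩ := exists_val_sub_eq (y' ν) (c ν)
  rw [show (y ν - c ν) = (y - c) ν from rfl] at hk₁
  rw [show (y' ν - c ν) = (y' - c) ν from rfl] at hk₂
  have hle := circAbs_le_tdist hP (toSite M y) (toSite M y') ν
  have hval : (((toSite M y ν).val : ℤ)) - ((toSite M y' ν).val : ℤ) = (((y - c) ν).val : ℤ) - (((y' - c) ν).val : ℤ) + (M ν : ℤ) * (k₂ - k₁) := by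
    show (((y ν).val : ℤ)) - ((y' ν).val : ℤ) = _
    linarith
  rw [hval, circAbs_add_mul] at hle
  -- the circular distance of `A − B ∈ [qw − m₀ − 2w, 2qw − 1 − m₀]` is `≥ m₀ + 1`
  set A : ℤ := (((y - c) ν).val : ℤ) with hAdef
  set B : ℤ := (((y' - c) ν).val : ℤ) with hBdef
  have hMν : (M ν : ℤ) = 2 * q * w := by rw [hM ν]; push_cast; ring
  have hA1 : (q : ℤ) * w ≤ A := by rw [hAdef]; exact_mod_cast hν
  have hA2 : A < 2 * q * w := by rw [hAdef, ← hMν]; exact_mod_cast hA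
  have hB1' : (m₀ : ℤ) ≤ B := by rw [hBdef]; exact_mod_cast hB1
  have hB2' : B + 1 ≤ m₀ + 2 * w := by rw [hBdef]; exact_mod_cast hB2
  have hfit' : 2 * (m₀ : ℤ) + 2 * w + 1 ≤ q * w := by exact_mod_cast hfit
  have hcirc : (m₀ : ℤ) + 1 ≤ circAbs (M ν) (A - B) := by
    unfold circAbs
    rw [hMν, Int.emod_eq_of_lt (by linarith) (by linarith)]
    exact le_min (by linarith) (by linarith)
  have : ((m₀ : ℤ) + 1 : ℤ) ≤ circAbs (M ν) (A - B) := hcirc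
  have hcast : ((m₀ : ℝ)) + 1 = (((m₀ : ℤ) + 1 : ℤ) : ℝ) := by push_cast; ring
  rw [hcast]
  exact (Int.cast_le.mpr this).trans hle

end Overlap

end Summit.QuantumFields.YangMills.BalabanUVNodes.N15.Gluing

end
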